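import Summits.NavierStokesRegularity.NavierStokesRegularity.Theorems.HarmonicShellLaplacian
import HarnessLib

/-!
# HarmonicShellRadial — plate R «RadialShell» of ROUND-41 «IsotropicBlobPressureLaw»
# (the 1-D shell identity in the profile currency: `Δ(φ(|x|²) Z) = (4sφ″ + (4l+6)φ′) Z`)

ROUND-41's witness pressure is `p(x) = Σ_l Φ_l(|x|²)·Z_l(x)` with three 1-D zonal profiles `Φ_l` (nsreg-p1 g33,
«Glue1D» 2026-08-28T22:20:01Z) and harmonic homogeneous polynomials `Z_l`. This file supplies, on
`EuclideanSpace ℝ (Fin 3)` and at EVERY point `x` (origin included; the profile `g` is a function of `s = ‖x‖²`,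
of class `C²` AT `‖x‖²`, and `h` is `C²` AT `x`, harmonic there with the Euler identity `⟪x, ∇h(x)⟫ = l·h(x)`):

* (R1) `laplacian_radial_mul`: `Δ(g(‖·‖²) h)(x) = (4‖x‖² g″(‖x‖²) + (4l+6) g′(‖x‖²))·h(x)` — with `g` a glued
  `C²` profile this gives `Δp = f` inside, outside and ON the sphere pointwise, one line per `l`; for the exterior
  multipole profile `c·s^{−(2l+1)/2}` the bracket vanishes (`laplacian_radial_mul` + the ODE identity);
* (R2) `contDiffAt_radial_mul`: `g ∘ ‖·‖² · h` is `C^n` at `x` when `g` is `C^n` at `‖x‖²` and `h` at `x`;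
* (R3) `fderiv_radial_mul_apply`: `D(g(‖·‖²) h)(x) v = g(‖x‖²)·Dh(x) v + 2g′(‖x‖²)⟪x,v⟫·h(x)`;
* (R4) `fderiv_fderiv_radial_mul_apply`: the Hessian
  `D²(g(‖·‖²) h)(x)(v)(w) = g D²h(v)(w) + 2g′(⟪x,v⟫Dh w + ⟪x,w⟫Dh v + ⟪v,w⟫h) + 4g″⟪x,v⟫⟪x,w⟫h`
  (all profiles at `‖x‖²`) — at `x = 0`: `D²p(0)(v,w) = Σ_l [Φ_l(0)·D²Z_l(0)(v,w) + 2Φ_l′(0)⟪v,w⟫Z_l(0)]`, the centre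
  pressure Hessian of the witness by `norm_num` on the profile coefficients.

Engine: the pointwise Leibniz rule `Literature.Analysis.PDE.LoewnerNirenberg.laplacian_smul_apply` and the radial
calculus `Literature.Analysis.FluidPDE.{hasFDerivAt_comp_norm_sq, fderiv_comp_norm_sq_apply, laplacian_comp_norm_sq}`
(`ΔG = 4g″‖x‖² + 2·3·g′`, `∇G = 2g′x` for `G = g(‖·‖²)` in `ℝ³`). Everything proved; no definitions, no named facts;
`--supports stmt-NavierStokesRegularity-0056 --as helper` (typed by ns-s29-p2 g5 for the LEAD S-door ns-s30-p1 g4 /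
nsreg-p1 g33, plate map v2 W2). [folklore]

HONEST FRAME: generic calculus plates for a kinematic slice law calibrating the S40/S41 clock doors; items 0056
`NoTypeII`, 10661 and NS regularity are NOT proved; nothing here is a route or a summit statement.
-/

noncomputable section

open Set Filter InnerProductSpace
open scoped Laplacian RealInnerProductSpace Topology ContDiff

set_option linter.dupNamespace false

namespace Summit.NavierStokesRegularity.NavierStokesRegularity.Theorems.StrainDoors.HarmonicShell

/-- A `C²` profile is differentiable, with derivative `deriv g`, on an open set of parameters around the point,
and `deriv g` is differentiable at the point. [folklore] -/
theorem exists_isOpen_hasDerivAt_of_contDiffAt {g : ℝ → ℝ} {σ : ℝ} (hg : ContDiffAt ℝ 2 g σ) :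
    (∃ U : Set ℝ, IsOpen U ∧ σ ∈ U ∧ ∀ τ ∈ U, HasDerivAt g (deriv g τ) τ) ∧
      HasDerivAt (deriv g) (deriv (deriv g) σ) σ := by
  refine ⟨?_, ?_⟩
  · have hev : ∀ᶠ τ in 𝓝 σ, HasDerivAt g (deriv g τ) τ :=
      (hg.eventually (by simp)).mono fun τ hτ => (hτ.differentiableAt (by simp)).hasDerivAt
    obtain ⟨U, hU, hUo, hσU⟩ := eventually_nhds_iff.1 hev
    exact ⟨U, hUo, hσU, hU⟩
  · have hd : DifferentiableAt ℝ (fun τ => fderiv ℝ g τ 1) σ :=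
      (Literature.Analysis.PDE.LoewnerNirenberg.differentiableAt_fderiv_of_contDiffAt hg).clm_apply
        (differentiableAt_const (1 : ℝ))
    exact hd.hasDerivAt

/-- **(R2)** `g(‖·‖²)·h` is `C^n` at `x` when `g` is `C^n` at `‖x‖²` and `h` is `C^n` at `x`. [folklore] -/
theorem contDiffAt_radial_mul {n : WithTop ℕ∞} {g : ℝ → ℝ} {h : EuclideanSpace ℝ (Fin 3) → ℝ}
    {x : EuclideanSpace ℝ (Fin 3)} (hg : ContDiffAt ℝ n g (‖x‖ ^ 2)) (hh : ContDiffAt ℝ n h x) :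
    ContDiffAt ℝ n (fun y => g (‖y‖ ^ 2) * h y) x :=
  (hg.comp x (contDiff_norm_sq ℝ).contDiffAt).mul hh

/-- **(R1) The 1-D shell identity**: for `g` of class `C²` at `‖x‖²` and `h` of class `C²` at `x`, harmonic at
`x` with the Euler identity `⟪x, ∇h(x)⟫ = l·h(x)`:
`Δ(g(‖·‖²) h)(x) = (4‖x‖² g″(‖x‖²) + (4l + 6) g′(‖x‖²))·h(x)` — valid at every `x`, the origin included
(`ΔG = 4sg″ + 6g′`, `2⟪∇G, ∇h⟫ = 4g′·l·h`, `GΔh = 0`). [folklore] -/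
theorem laplacian_radial_mul (l : ℝ) {g : ℝ → ℝ} {h : EuclideanSpace ℝ (Fin 3) → ℝ}
    {x : EuclideanSpace ℝ (Fin 3)} (hg : ContDiffAt ℝ 2 g (‖x‖ ^ 2)) (hh : ContDiffAt ℝ 2 h x) (hΔ : Δ h x = 0)
    (hE : ⟪x, gradient h x⟫ = l * h x) :
    Δ (fun y => g (‖y‖ ^ 2) * h y) x =
      (4 * ‖x‖ ^ 2 * deriv (deriv g) (‖x‖ ^ 2) + (4 * l + 6) * deriv g (‖x‖ ^ 2)) * h x := by
  set b := stdOrthonormalBasis ℝ (EuclideanSpace ℝ (Fin 3))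
  obtain ⟨⟨U, hUo, hxU, hU⟩, hg₁⟩ := exists_isOpen_hasDerivAt_of_contDiffAt hg
  have hG2 : ContDiffAt ℝ 2 (fun y : EuclideanSpace ℝ (Fin 3) => g (‖y‖ ^ 2)) x :=
    hg.comp x (contDiff_norm_sq ℝ).contDiffAt
  have hfun : (fun y => g (‖y‖ ^ 2) * h y) = fun y => g (‖y‖ ^ 2) • h y := by
    funext y
    rw [smul_eq_mul]
  rw [hfun, Literature.Analysis.PDE.LoewnerNirenberg.laplacian_smul_apply hG2 hh b, hΔ, smul_zero, add_zero,
    Literature.Analysis.FluidPDE.laplacian_comp_norm_sq (E := EuclideanSpace ℝ (Fin 3)) hUo hU hxU hg₁]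
  have hD : ∀ i, fderiv ℝ (fun y : EuclideanSpace ℝ (Fin 3) => g (‖y‖ ^ 2)) x (b i) =
      2 * deriv g (‖x‖ ^ 2) * ⟪x, b i⟫ := fun i =>
    Literature.Analysis.FluidPDE.fderiv_comp_norm_sq_apply (hU _ hxU) (b i)
  simp only [hD, smul_eq_mul]
  have hEul : fderiv ℝ h x x = l * h x := by
    rw [← hE, real_inner_comm, gradient, toDual_symm_apply]
  have hsum : ∑ i, 2 * deriv g (‖x‖ ^ 2) * ⟪x, b i⟫ * fderiv ℝ h x (b i) =
      2 * deriv g (‖x‖ ^ 2) * (l * h x) := by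
    rw [← hEul, ← sum_inner_mul_fderiv_eq b h x, Finset.mul_sum]
    exact Finset.sum_congr rfl fun i _ => by ring
  rw [hsum, finrank_euclideanSpace_fin]
  push_cast
  ring

/-- **(R3) First derivative of `g(‖·‖²) h`**: `D(g(‖·‖²) h)(x) v = g(‖x‖²)·Dh(x) v + 2g′(‖x‖²)⟪x,v⟫·h(x)`,
for `g` differentiable at `‖x‖²` and `h` differentiable at `x`. [folklore] -/
theorem fderiv_radial_mul_apply {g : ℝ → ℝ} {h : EuclideanSpace ℝ (Fin 3) → ℝ} {x : EuclideanSpace ℝ (Fin 3)}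
    (hg : DifferentiableAt ℝ g (‖x‖ ^ 2)) (hh : DifferentiableAt ℝ h x) (v : EuclideanSpace ℝ (Fin 3)) :
    fderiv ℝ (fun y => g (‖y‖ ^ 2) * h y) x v =
      g (‖x‖ ^ 2) * fderiv ℝ h x v + 2 * deriv g (‖x‖ ^ 2) * ⟪x, v⟫ * h x := by
  have hG := Literature.Analysis.FluidPDE.hasFDerivAt_comp_norm_sq (E := EuclideanSpace ℝ (Fin 3)) hg.hasDerivAt
  rw [(hG.fun_mul hh.hasFDerivAt).fderiv]
  simp only [_root_.add_apply, FunLike.coe_smul, Pi.smul_apply, innerSL_apply_apply, smul_eq_mul]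
  ring

/-- **(R4) Hessian of `g(‖·‖²) h`** at any `x`, for `g` of class `C²` at `‖x‖²` and `h` of class `C²` at `x`:
`D²(g(‖·‖²) h)(x)(v)(w) = g D²h(x)(v)(w) + 2g′(⟪x,v⟫Dh(x) w + ⟪x,w⟫Dh(x) v + ⟪v,w⟫h(x)) + 4g″⟪x,v⟫⟪x,w⟫h(x)`
(profiles at `‖x‖²`). At `x = 0`: `D²(g(‖·‖²)h)(0)(v)(w) = g(0)D²h(0)(v)(w) + 2g′(0)⟪v,w⟫h(0)`. [folklore] -/
theorem fderiv_fderiv_radial_mul_apply {g : ℝ → ℝ} {h : EuclideanSpace ℝ (Fin 3) → ℝ}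
    {x : EuclideanSpace ℝ (Fin 3)} (hg : ContDiffAt ℝ 2 g (‖x‖ ^ 2)) (hh : ContDiffAt ℝ 2 h x)
    (v w : EuclideanSpace ℝ (Fin 3)) :
    fderiv ℝ (fderiv ℝ (fun y => g (‖y‖ ^ 2) * h y)) x v w =
      g (‖x‖ ^ 2) * fderiv ℝ (fderiv ℝ h) x v w
        + 2 * deriv g (‖x‖ ^ 2) * (⟪x, v⟫ * fderiv ℝ h x w + ⟪x, w⟫ * fderiv ℝ h x v + ⟪v, w⟫ * h x)
        + 4 * deriv (deriv g) (‖x‖ ^ 2) * ⟪x, v⟫ * ⟪x, w⟫ * h x := by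
  obtain ⟨⟨U, hUo, hxU, hU⟩, hg₁⟩ := exists_isOpen_hasDerivAt_of_contDiffAt hg
  have hF2 : ContDiffAt ℝ 2 (fun y => g (‖y‖ ^ 2) * h y) x := contDiffAt_radial_mul hg hh
  rw [Literature.Analysis.PDE.LoewnerNirenberg.fderiv_fderiv_apply_eq_fderiv_apply
      (Literature.Analysis.PDE.LoewnerNirenberg.differentiableAt_fderiv_of_contDiffAt hF2) v w,
    Literature.Analysis.PDE.LoewnerNirenberg.fderiv_fderiv_apply_eq_fderiv_apply
      (Literature.Analysis.PDE.LoewnerNirenberg.differentiableAt_fderiv_of_contDiffAt hh) v w]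
  -- near `x`: `g` differentiable at `‖y‖²` (as `‖y‖² ∈ U`) and `h` differentiable at `y`, so (R3) applies
  have hU' : ∀ᶠ y in 𝓝 x, ‖y‖ ^ 2 ∈ U :=
    (contDiff_norm_sq ℝ (n := 0)).continuous.continuousAt.preimage_mem_nhds (hUo.mem_nhds hxU)
  have hdiff : ∀ᶠ y in 𝓝 x, DifferentiableAt ℝ h y :=
    Literature.Analysis.PDE.LoewnerNirenberg.eventually_differentiableAt_of_contDiffAt hh
  have heq : (fun y => fderiv ℝ (fun y => g (‖y‖ ^ 2) * h y) y w) =ᶠ[𝓝 x]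
      fun y => g (‖y‖ ^ 2) * fderiv ℝ h y w + 2 * deriv g (‖y‖ ^ 2) * ⟪w, y⟫ * h y := by
    filter_upwards [hU', hdiff] with y hy hdy
    rw [fderiv_radial_mul_apply (hU _ hy).differentiableAt hdy w, real_inner_comm y w]
  rw [heq.fderiv_eq]
  -- differentiate the explicit expression at `x`
  have h1 : HasFDerivAt (fun y : EuclideanSpace ℝ (Fin 3) => g (‖y‖ ^ 2))
      ((2 * deriv g (‖x‖ ^ 2)) • (innerSL ℝ x : EuclideanSpace ℝ (Fin 3) →L[ℝ] ℝ)) x :=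
    Literature.Analysis.FluidPDE.hasFDerivAt_comp_norm_sq (E := EuclideanSpace ℝ (Fin 3)) (hU _ hxU)
  have h2 : HasFDerivAt (fun y : EuclideanSpace ℝ (Fin 3) => deriv g (‖y‖ ^ 2))
      ((2 * deriv (deriv g) (‖x‖ ^ 2)) • (innerSL ℝ x : EuclideanSpace ℝ (Fin 3) →L[ℝ] ℝ)) x :=
    Literature.Analysis.FluidPDE.hasFDerivAt_comp_norm_sq (E := EuclideanSpace ℝ (Fin 3)) hg₁
  have h3 : HasFDerivAt (fun y => fderiv ℝ h y w) (fderiv ℝ (fun y => fderiv ℝ h y w) x) x :=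
    ((Literature.Analysis.PDE.LoewnerNirenberg.differentiableAt_fderiv_of_contDiffAt hh).clm_apply
      (differentiableAt_const w)).hasFDerivAt
  have h4 : HasFDerivAt h (fderiv ℝ h x) x := (hh.differentiableAt (by norm_num)).hasFDerivAt
  have h5 : HasFDerivAt (fun y : EuclideanSpace ℝ (Fin 3) => ⟪w, y⟫)
      (innerSL ℝ w : EuclideanSpace ℝ (Fin 3) →L[ℝ] ℝ) x :=
    (innerSL ℝ w : EuclideanSpace ℝ (Fin 3) →L[ℝ] ℝ).hasFDerivAt
  have hG := (h1.fun_mul h3).fun_add (((h2.const_mul 2).fun_mul h5).fun_mul h4)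
  rw [hG.fderiv]
  simp only [_root_.add_apply, FunLike.coe_smul, Pi.smul_apply, innerSL_apply_apply, smul_eq_mul,
    real_inner_comm w x, real_inner_comm w v]
  ring

end Summit.NavierStokesRegularity.NavierStokesRegularity.Theorems.StrainDoors.HarmonicShell

end
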